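import Literature.NumberTheory.EllipticCurves.GrossPointsThetaElementFacts
import Literature.NumberTheory.EllipticCurves.ModularDegreeMinimal
import Literature.NumberTheory.EllipticCurves.QuadraticTwist
import Literature.NumberTheory.EllipticCurves.MordellWeil
import Literature.NumberTheory.EllipticCurves.Tamagawa
import HarnessLib

/-!
# Bertolini–Darmon 2005, Corollary 3: the anticyclotomic `p`-adic `L`-function of `E/ℚ` over `K`
# vanishes at the trivial character to order at least `2 · max(r⁺, r⁻)` (good ordinary `p`)

Topic `Literature/NumberTheory/EllipticCurves`, folder `BertoliniDarmon2005/` (next to `AdmissiblePrimes.lean`).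
ONE named fact (`def … : Prop`, D-0014), stated in the vocabulary of the tree's definite theta elements
(`Literature.NumberTheory.EllipticCurves.GrossPointTower.thetaAc`, file `GrossPointsThetaElement`), exactly as the
three facts of `GrossPointsThetaElementFacts` (`nonempty_grossPointTower`, `grossPointTower_isNormCompatible`,
`vatsal_hasMuZeroAc`) are; nothing is proved, nothing else is asserted, no `sorry`, no instance, no notation.
Typed by the cell `b2b-bsdres` (seat `b2b-bsdres-x10b`, gen 47) for the crux `DerivedHeightCap` of route
`DefiniteTheta` (stmt-BirchSwinnertonDyer-18438), whose docstrings (`GrossPointTower.acOrderOfVanishing`,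
`Cruxes/DerivedHeightCap/Lines/birth.lean`) already name this corollary as the printed source of the bound.
HONEST FRAMING: a published statement is vendored as a hypothesis-shaped `Prop`; BSD is not proved by any of this.

## Source, verbatim

M. Bertolini, H. Darmon, *Iwasawa's Main Conjecture for elliptic curves over anticyclotomic `ℤ_p`-extensions*,
Ann. of Math. 162 (2005) 1–64 [BertoliniDarmon2005] (held text `paper:doi-10-4007-annals-2005-162-1`).

* p. 2: "Let `N₀` denote the conductor of `E`, set `N = pN₀` if `E` has good ordinary reduction at `p` […]. It
  will be assumed throughout that the discriminant of `K` is prime to `N`, so that `K` determines a factorisation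
  `N = pN⁺N⁻`, where `N⁺` (resp. `N⁻`) is divisible only by primes different from `p` which are split (resp.
  inert) in `K`." "**Theorem 1.** Assume that `N⁻` is the square-free product of an odd number of primes. The
  characteristic power series `𝒞` divides the `p`-adic `L`-function `L_p(E, K)`."
* p. 2–3: "set `E⁺ = E` and let `E⁻` be the elliptic curve over `ℚ` obtained by twisting `E` by `K`. Write `r^±`
  for the rank of `E^±(ℚ)`, so that `r = r⁺ + r⁻`. Set `r̃^± = r^± + δ^±`, where `δ^± = 1` if `E^±` has split
  multiplicative reduction at `p`, `0` otherwise. Finally set `ρ := max(r̃⁺, r̃⁻)` […]."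
* p. 3: "**Corollary 3.** If `p` is a prime of good ordinary reduction for `E`, then
  `ord_{s=1} L_p(E, K, s) ≥ 2ρ`." (preceded by: "A more careful study of the `Λ`-module structure of
  `Sel(K_∞, E_{p^∞})`, which in the good ordinary reduction case is carried out in [BD0] and [BD½], yields the
  following refinement of Corollary 2".)
* p. 4, "**Assumption 6.** (1) The prime `p` is `≥ 5`. (2) The Galois representation attached to `E_p` has image
  isomorphic to `GL₂(𝔽_p)`. (3) The prime `p` does not divide the minimal degree of a modular parametrisation
  `X₀(N₀) → E`. (4) For all primes `ℓ` such that `ℓ²` divides `N`, and `p` divides `ℓ + 1`, the module `E_p` is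
  an irreducible `I_ℓ`-module." ("it is assumed throughout the paper that `(E, K, p)` satisfies" these.)
* §1.2, p. 10–12: (13) `G̃_∞ = K̂^× / (ℚ̂^× ∏_{ℓ ≠ p} 𝒪_{K,ℓ}^× K^×)`; (18) `U_n = (1 + pⁿ𝒪_K ⊗ ℤ_p)^×/(1 + pⁿℤ_p)^×`,
  `G̃_n := G̃_∞ / U_n` "so that `G̃_∞` is the inverse limit of the finite groups `G̃_n`"; (20) the distribution
  `ν̃_f(σU_j) := α_p^{-j} [σ, e_j]_f`, `(L̃_f)_n := Σ_{g ∈ G̃_n} ν̃_f(gU_n) · g`; (21) "Let `Δ` denote the torsion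
  subgroup of `G̃_∞`, and let `G_∞ = G̃_∞/Δ ≃ ℤ_p`. Write `L_f` for the natural image of `L̃_f` in the Iwasawa
  algebra `Λ = ℤ_p⟦G_∞⟧ ≃ ℤ_p⟦T⟧`"; "The Iwasawa algebra is equipped with the involution `θ ↦ θ^*` sending any
  `σ ∈ G_∞` to `σ⁻¹`"; Def. 1.6: `L_p(f, K) = L_f L_f^*`; "The function `L_p(f, K, s)` is defined to be the
  `p`-adic Mellin transform of `μ_{f,K}`: `L_p(f, K, s) := ∫_{G_∞} g^{s-1} dμ_{f,K}(g)`"; (22)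
  `L_p(E, K) := L_p(f_E, K)`, `L_p(E, K, s) := L_p(f_E, K, s)`, `f_E` the `ℤ_p`-valued eigenform on the definite
  quaternion algebra of discriminant `N⁻` and Eichler level `N⁺` attached to `E` by Jacquet–Langlands
  (Prop. 1.3–1.4, "unique up to multiplication by a scalar in `ℤ_p^×`").

## Transcription (tree vocabulary; cf. the faithfulness notes of `GrossPointsThetaElementFacts`)

* `G̃_n = G̃_∞/U_n` of (13), (18) is the Picard group `Pic(𝒪_{pⁿ})` of the order of conductor `pⁿ`
  (`K^×\K̂^×/∏_ℓ 𝒪_{pⁿ,ℓ}^×`; the extra quotient by `ℚ̂^× = ℚ^×_{>0} ∏ ℤ_ℓ^×` is automatic) — the groups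
  `ClassGroup (quadOrder K (p ^ n))` of the tree's towers; `Δ ↦ torsionImage`, `G̃_n/ im Δ = AcLayerGroup K p n`
  (BD05 define `G̃_∞` idelically, so NO class field theory enters the statement). `(L̃_f)_n` is, up to a unit of
  `ℤ_p` and translation by a group element (choice of the end `(e_j)`, i.e. of the tower; BD05 p. 11: "a
  different choice of edges `e_j` … has the effect of multiplying `L_f` by an element of `G_∞`"), the theta element
  `θ_n` of Bertolini–Darmon 1996 §2.7 built from a tower of Gross points and the `a(E)`-eigenvector `φ`
  (`GrossPointTower.theta`; normalisations compared in the module docstring of `GrossPointsThetaElement`: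
  `ν̃_f(σU_j) = -α_p · z_j(σ)`), so the image of `L_p(E, K) = L_f L_f^*` in `ℤ_p[G_{n+1}^{ac}]` is, up to a unit,
  `θ_{n+1}^{ac} · (θ_{n+1}^{ac})^*` with `θ^{ac} = GrossPointTower.thetaAc` and `(·)^* = MonoidAlgebra.mapDomain (·⁻¹)`.
* "`ord_{s=1} L_p(E, K, s) ≥ m`": with `Λ ≃ ℤ_p⟦T⟧`, `γ ↦ 1 + T`, the Mellin transform is
  `L_p(E,K,s) = F(u^{s-1} - 1)` for the power series `F ↔ L_p(E,K)` and `u = γ` read in `1 + pℤ_p` through `log`,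
  so `ord_{s=1} L_p(E,K,s) = ord_T F`, the order of `L_p(E,K)` in the augmentation filtration `J^m = (T^m)` of
  `Λ`; and since the ideals `J^m` are closed and `Λ = lim ℤ_p[G_n]`, `L_p(E,K) ∈ J^m` iff ALL its finite-level
  images lie in `I_n^m`, `I_n` the augmentation ideal of `ℤ_p[G_n^{ac}]` (BD96 §2.12's definition of the order of
  vanishing, the tree's `GrossPointTower.VanishesToOrderAc`). Units and group elements do not change membership
  in `I_n^m`. Hence the conclusion below: `θ_{n+1}^{ac} (θ_{n+1}^{ac})^* ∈ I_{n+1}^{2ρ}` for every `n`.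
* `ρ = max(r̃⁺, r̃⁻)` with `δ^± = 0` because `p` is a prime of GOOD reduction: `r⁺ = rank E(ℚ) =
  W.mordellWeilRank`, `r⁻ = rank E^K(ℚ) = (W.quadraticTwist d_K).mordellWeilRank` ("twisting `E` by `K`" =
  the quadratic twist by `d_K = NumberField.discr K`, as in `BSDSelmerSkinnerThmBProofs`).
* Hypotheses, as printed: `E/ℚ` on a model `W` with `N₀ = W.conductorNorm ℤ = N⁺N⁻`; `p` good
  (`HasGoodReductionAtPrime`) ordinary (`p ∤ a_p`, `a_p = W.LFunction p`); `(disc K, pN₀) = 1`; `K` imaginary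
  quadratic (forced by `K ⊂ B` definite); `N⁻` square-free (field `squarefree` of the Brandt setup `S` of type
  `(N⁺, N⁻)`, the definite quaternion algebra of discriminant `N⁻` with an Eichler order of level `N⁺`) with an
  odd number of prime factors, its primes inert and those of `N⁺` split in `K` (BD05 §1.2: the optimal embedding
  `Ψ` "exists if and only if all the primes dividing `N⁺` are split in `K`"); `φ` a generator of the
  `a(E)`-eigen-line of the Brandt module (`Brandt.eigenLattice … = ℤ ∙ φ`, BD05 Prop. 1.4's `f_E` up to `ℤ_p^×`);
  Assumption 6 (1) `5 ≤ p`, (2) `W.HasSurjectiveModNGaloisRep p`, (3) `¬ p ∣ minModularDegree W N₀` (the tree's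
  minimal modular degree at level `N₀`, file `ModularDegreeMinimal`), and (4) in the SPECIAL CASE in which it is
  vacuous: no prime `ℓ` with `ℓ² ∣ N₀` has `p ∣ ℓ + 1`.
  -- TODO(general form): Assumption 6 (4) only asks, for `ℓ² ∣ N` with `p ∣ ℓ + 1`, that `E[p]` be an
  -- irreducible `I_ℓ`-module; the tree has no inertia-irreducibility predicate at `ℓ` yet.
* Provenance note (not part of the statement): BD05 derive Cor. 3 from Thm. 1 and the `Λ`-module structure theory
  of [BD0] = Bertolini–Darmon, Duke Math. J. 76 (1994) and [BD½] = Bertolini–Darmon, Amer. J. Math. 117 (1995)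
  (derived `p`-adic heights: Thm. 2.18, Thm. 2.23, Lemma 3.1 there), whose own standing assumptions (§1.1 of the
  latter: `p ∤ 2·#(𝓔/𝓔⁰)(E/K)`, good reduction above `p`, a Cartan subgroup in the image of `ρ̄`, surjective local
  norms) are not repeated in the printed corollary; the fact below records the corollary AS PRINTED (Assumption 6,
  `N⁻` square-free with an odd number of prime factors, `p` good ordinary).

## References

* [BertoliniDarmon2005] Ann. of Math. 162 (2005): Thm. 1 and Cor. 3 (pp. 2–3), Assumption 6 (p. 4), §1.2
  (13), (18)–(22), Lemma 1.5, Def. 1.6 (pp. 10–13).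
* [BertoliniDarmon1996] Invent. Math. 126 (1996), §2.7, §2.12 (finite-level order of vanishing), Conj. 4.1.
* [BertoliniDarmon1995] Amer. J. Math. 117 (1995), §1.1, Thm. 2.18, Thm. 2.23, Cor. 2.24, Lemma 3.1, Conj. 3.7.
-/

noncomputable section

open scoped Matrix
open NumberField Literature.NumberTheory.Automorphic

universe u

namespace Literature.NumberTheory.EllipticCurves.BertoliniDarmon2005

variable (K : Type u) [Field K] [NumberField K] {Nplus Nminus : ℕ}
  (S : Brandt.XiSetup Nplus Nminus) (p : ℕ) [Fact p.Prime]

/-- **Bertolini–Darmon 2005, Corollary 3** ("If `p` is a prime of good ordinary reduction for `E`, then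
`ord_{s=1} L_p(E, K, s) ≥ 2ρ`", `ρ = max(r̃⁺, r̃⁻)`, `r^±` the ranks of `E(ℚ)` and of the twist `E^K(ℚ)` ("`E⁻` the
elliptic curve over `ℚ` obtained by twisting `E` by `K`"), `δ^± = 0` at a good prime; stated under the paper's standing
Assumption 6 — "(1) The prime `p` is `≥ 5`. (2) The Galois representation attached to `E_p` has image isomorphic to
`GL₂(𝔽_p)`. (3) The prime `p` does not divide the minimal degree of a modular parametrisation `X₀(N₀) → E`. (4) For all
primes `ℓ` such that `ℓ²` divides `N`, and `p` divides `ℓ + 1`, the module `E_p` is an irreducible `I_ℓ`-module" — and the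
hypothesis of Theorem 1, "`N⁻` is the square-free product of an odd number of primes", with `N = pN₀`, `N₀ = N⁺N⁻` the
conductor, "the discriminant of `K` is prime to `N`", primes of `N⁺` split and of `N⁻` inert in `K`), in the finite-level
vocabulary of the tree's definite theta elements (as `vatsal_hasMuZeroAc`): BD05 §1.2 (13), (18) define
`G̃_∞ = K̂^×/(ℚ̂^× ∏_{ℓ≠p} 𝒪_{K,ℓ}^× K^×) = lim G̃_n`, `G̃_n = Pic(𝒪_{pⁿ})` (idelically — no class field theory), (20)–(21)
`(L̃_f)_n = Σ_g ν̃_f(gU_n) g`, `L_f` = image in `Λ = ℤ_p⟦G̃_∞/Δ⟧`, Def. 1.6 `L_p(f,K) = L_f L_f^*` (`*` : `σ ↦ σ⁻¹`), (22)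
`L_p(E,K) = L_p(f_E,K)`, and `L_p(E,K,s)` its `p`-adic Mellin transform; `ord_{s=1} L_p(E,K,s)` is the order of `L_p(E,K)`
in the augmentation filtration of `Λ = lim ℤ_p[G_n^{ac}]`, i.e. (closed ideals; BD96 §2.12) `L_p(E,K) ∈ J^m` iff every
finite-level image lies in `I_n^m`; `(L̃_f)_n` is the tree's `θ_n` up to `ℤ_p^×` and a group element (BD05 p. 11), which do
not change membership in `I_n^m`. So: let `E/ℚ` (model `W`, conductor `N₀ = N⁺N⁻`) have good ordinary reduction at
`p ≥ 5` (`p ∤ a_p`), `ρ̄_{E,p}` onto `GL₂(𝔽_p)`, `p ∤` the minimal modular degree at level `N₀`, and — SPECIAL CASE making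
(4) vacuous — no prime `ℓ` with `ℓ² ∣ N₀` and `p ∣ ℓ + 1`; `K` imaginary quadratic with `(d_K, pN₀) = 1`, primes of `N⁺`
split, of the square-free `N⁻` (odd number of prime factors) inert; `S` a Brandt setup of type `(N⁺, N⁻)`, `φ` a
generator of the `a(E)`-eigen-line. Then for every tower `T` of Gross points of conductor `pⁿ` and every level,
`θ_{n+1}^{ac} (θ_{n+1}^{ac})^* ∈ I^{2·max(rank E(ℚ), rank E^K(ℚ))}` in `ℤ_p[G_{n+1}^{ac}]`.
-- TODO(general form): Assumption 6 (4) only requires, for `ℓ² ∣ N` with `p ∣ ℓ + 1`, that `E[p]` be an irreducible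
-- `I_ℓ`-module (no inertia-irreducibility predicate in the tree yet); Cor. 3 is also printed for all `p ≥ 5`.
Provenance (not part of the statement): BD05 obtain Cor. 3 from Thm. 1 and the `Λ`-module structure theory of
Bertolini–Darmon 1994 (Duke) / 1995 (Amer. J. Math.: Thm. 2.18, Thm. 2.23, Lemma 3.1), whose own standing assumptions
(1995 §1.1: `p ∤ 2·#(𝓔/𝓔⁰)(E/K)`, a Cartan subgroup in the image, surjective local norms) are not repeated in the printed
corollary; recorded here AS PRINTED.
[cite: BertoliniDarmon2005, Cor. 3 (p. 3); Assumption 6 (p. 4); Thm. 1 (p. 2); §1.2 (13)–(22) and Def. 1.6 (pp. 10–13)]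
[cite: BertoliniDarmon1996, §2.12 (order of vanishing at finite level)] -/
def cor3_thetaSq_mem_augIdeal_pow (W : WeierstrassCurve ℚ) : Prop :=
  ∀ [W.IsElliptic] [Fintype (Brandt.ClassSet S.O)] [NeZero (W.conductorNorm ℤ)], IsImaginaryQuadratic K →
    5 ≤ p → Nplus * Nminus = W.conductorNorm ℤ →
    (Nplus * Nminus * p).Coprime (NumberField.discr K).natAbs → Odd Nminus.primeFactors.card →
    (∀ ℓ : ℕ, ℓ.Prime → ℓ ∣ Nplus → ((Ideal.span {(ℓ : ℤ)}).primesOver (𝓞 K)).ncard = 2) →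
    (∀ ℓ : ℕ, ℓ.Prime → ℓ ∣ Nminus → ((Ideal.span {(ℓ : ℤ)}).primesOver (𝓞 K)).ncard = 1) →
    W.HasGoodReductionAtPrime p → ¬ (p : ℤ) ∣ W.LFunction p → W.HasSurjectiveModNGaloisRep p →
    ¬ p ∣ ModularForms.minModularDegree W (W.conductorNorm ℤ) →
    (∀ ℓ : ℕ, ℓ.Prime → ℓ ^ 2 ∣ Nplus * Nminus → ¬ p ∣ ℓ + 1) →
    ∀ (φ : Brandt.ClassSet S.O → ℤ), φ ≠ 0 →
      Brandt.eigenLattice (Nplus * Nminus) (Brandt.matrix S.O) (fun n => W.LFunction n) = ℤ ∙ φ →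
    ∀ (T : GrossPointTower K S p) (n : ℕ),
      T.thetaAc p φ (padicUnitRoot p (W.LFunction p)) n *
          MonoidAlgebra.mapDomain (fun σ => σ⁻¹) (T.thetaAc p φ (padicUnitRoot p (W.LFunction p)) n) ∈
        augIdeal ℤ_[p] (AcLayerGroup K p (n + 1)) ^
          (2 * max W.mordellWeilRank (W.quadraticTwist (NumberField.discr K : ℚ)).mordellWeilRank)

end Literature.NumberTheory.EllipticCurves.BertoliniDarmon2005

end
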